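import Summits.RiemannHypothesis.RiemannHypothesis.Theorems.SignConeCondRungRepresent
import Literature.Analysis.ValidatedNumerics.TrigLogTables

/-!
# Route SignCone — conditional rungs, VI: certified upper bounds for the honest weights `2Λ(n)/√n`

Items stmt-RiemannHypothesis-16301/16302. A tiny checker, in the style of the pointwise-certificate files, for a
table of rational upper bounds `hi n ≥ 2Λ(n)/√n` (`n ≤ N`): `Λ(n) = log(minFac n)` on prime powers (Mathlib
`vonMangoldt_apply`, `IsPrimePow` decidable), `log(minFac n) ≤` the engine's table value (`FI.mem_logTable`), and
`√n ≥ sqrtLo n` from `sqrtLo n² ≤ n`. Consequence: the SOS-free high-frequency bound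
`honestComb N y ≤ Σ_n hi n` (`honestComb_le_total`) — the trivial comb bound `M = Σ 2Λ(n)/√n` that already gives
the Platt–Trudgian instance of Theorem A at `N = 46` (cutoff `≈ 1.92`).
-/

noncomputable section

-- `Summit.RiemannHypothesis.RiemannHypothesis.…` repeats a namespace component by design (D-0017 layout).
set_option linter.dupNamespace false

open scoped BigOperators ArithmeticFunction.vonMangoldt
open Literature.Analysis.ValidatedNumerics.Numerics

namespace Summit.RiemannHypothesis.RiemannHypothesis.Theorems.SignCone

/-- `Σ_{n < m} f n` as a list sum. [folklore] -/
theorem finset_sum_range_eq_list_sum {α : Type*} [AddCommMonoid α] (f : ℕ → α) :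
    ∀ m : ℕ, ∑ n ∈ Finset.range m, f n = ((List.range m).map f).sum
  | 0 => by simp
  | m + 1 => by
    rw [Finset.sum_range_succ, finset_sum_range_eq_list_sum f m, List.range_succ, List.map_append,
      List.sum_append]
    simp

/-- A table of rational lower bounds for `√n` and upper bounds for `2Λ(n)/√n`, `n ≤ N`. [folklore] -/
structure CoefTable where
  /-- last node -/
  N : ℕ
  /-- `sqrtLo[n] ≤ √n` -/
  sqrtLo : List ℚ
  /-- `hi[n] ≥ 2Λ(n)/√n` -/
  hi : List ℚ

namespace CoefTable

variable (C : CoefTable)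

/-- `sqrtLo n`. [folklore] -/
def sq (n : ℕ) : ℚ := C.sqrtLo.getD n 0

/-- `hi n`. [folklore] -/
def hiAt (n : ℕ) : ℚ := C.hi.getD n 0

/-- The check at one node: `0 ≤ hi n`, and on prime powers `0 < sqrtLo n`, `sqrtLo n² ≤ n`,
`2 · loghi(minFac n) ≤ hi n · sqrtLo n`. [folklore] -/
def checkAt (logs : List FI) (n : ℕ) : Bool :=
  decide (0 ≤ C.hiAt n) &&
    (if IsPrimePow n then
      decide (0 < C.sq n) && decide (C.sq n ^ 2 ≤ n) &&
        decide (2 * (logs.getD n.minFac (FI.ofInt 0)).hiQ ≤ C.hiAt n * C.sq n)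
    else true)

/-- The whole check (log table of size `N` validated once). [folklore] -/
def check : Bool :=
  FI.logTableOK C.N && (List.range (C.N + 1)).all (C.checkAt (FI.logTable C.N))

/-- `Σ_{n ≤ N} hi n`. [folklore] -/
def total : ℚ := ((List.range (C.N + 1)).map C.hiAt).sum

/-- **Soundness at a node**: `0 ≤ hi n` and `2Λ(n)/√n ≤ hi n` for `n ≤ N`. [folklore] -/
theorem sound (h : C.check = true) {n : ℕ} (hn : n ≤ C.N) :
    0 ≤ (C.hiAt n : ℝ) ∧ 2 * Λ n / Real.sqrt n ≤ (C.hiAt n : ℝ) := by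
  unfold check at h
  rw [Bool.and_eq_true, List.all_eq_true] at h
  obtain ⟨hok, hall⟩ := h
  have hc := hall n (List.mem_range.2 (by omega))
  unfold checkAt at hc
  rw [Bool.and_eq_true, decide_eq_true_eq] at hc
  obtain ⟨h0, hc⟩ := hc
  have h0' : (0 : ℝ) ≤ C.hiAt n := by exact_mod_cast h0
  refine ⟨h0', ?_⟩
  rw [ArithmeticFunction.vonMangoldt_apply]
  by_cases hp : IsPrimePow n
  · simp only [hp, if_true] at hc ⊢
    rw [Bool.and_eq_true, Bool.and_eq_true, decide_eq_true_eq, decide_eq_true_eq, decide_eq_true_eq] at hc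
    obtain ⟨⟨hs0, hs2⟩, hle⟩ := hc
    have hs0' : (0 : ℝ) < C.sq n := by exact_mod_cast hs0
    have hsq : (C.sq n : ℝ) ≤ Real.sqrt n := by
      rw [Real.le_sqrt' hs0']; exact_mod_cast hs2
    have hmin : n.minFac ≤ C.N := (Nat.minFac_le hp.pos).trans hn
    have hlog : Real.log n.minFac ≤ (((FI.logTable C.N).getD n.minFac (FI.ofInt 0)).hiQ : ℝ) :=
      FI.le_hiQ (FI.mem_logTable hok hmin)
    have hle' : (2 : ℝ) * ((FI.logTable C.N).getD n.minFac (FI.ofInt 0)).hiQ ≤ C.hiAt n * C.sq n := by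
      exact_mod_cast hle
    rw [div_le_iff₀ (lt_of_lt_of_le hs0' hsq)]
    calc 2 * Real.log n.minFac ≤ 2 * (((FI.logTable C.N).getD n.minFac (FI.ofInt 0)).hiQ : ℝ) := by linarith
      _ ≤ C.hiAt n * C.sq n := hle'
      _ ≤ C.hiAt n * Real.sqrt n := mul_le_mul_of_nonneg_left hsq h0'
  · simp only [hp, if_false]
    rw [mul_zero, zero_div]
    exact h0'

/-- **The trivial comb bound**: `honestComb N y ≤ Σ_{n ≤ N} hi n` for every `y`. [folklore] -/
theorem honestComb_le_total (h : C.check = true) (y : ℝ) : honestComb C.N y ≤ (C.total : ℝ) := by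
  unfold honestComb total
  rw [← finset_sum_range_eq_list_sum]
  push_cast
  refine Finset.sum_le_sum fun n hn => ?_
  rw [Finset.mem_range] at hn
  obtain ⟨h0, hb⟩ := C.sound h (n := n) (by omega)
  have ha : 0 ≤ 2 * Λ n / Real.sqrt n :=
    div_nonneg (mul_nonneg zero_le_two ArithmeticFunction.vonMangoldt_nonneg) (Real.sqrt_nonneg _)
  calc 2 * Λ n / Real.sqrt n * Real.cos (y * Real.log n) ≤ 2 * Λ n / Real.sqrt n * 1 :=
        mul_le_mul_of_nonneg_left (Real.cos_le_one _) ha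
    _ ≤ C.hiAt n := by rw [mul_one]; exact hb

end CoefTable

end Summit.RiemannHypothesis.RiemannHypothesis.Theorems.SignCone

end
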